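import Summits.BirchSwinnertonDyer.BirchSwinnertonDyer.Theorems.ManinLocalTwoThreeTowerDuality

/-!
# FOURIER DUALITY in the `q`-tower at a fixed level `n`: «some level-`n` plus coordinate is `≢ 0 (mod p)`» ⟺ «some PRIMITIVE EVEN
# character of conductor `qⁿ` has UNIT normalised twisted value» (MEMO-an §71.3 as ONE equivalence; cell bsd-f2-manin, analytic lens g29)

Summit `BirchSwinnertonDyer`, route `ManinLocalTwoThree`, cruxes C3 `ManinPrimeToThreeAtNine` (stmt-BirchSwinnertonDyer-22968) / C2
`ManinOddAtFour` (stmt-…-22967).  `…TowerDescent` derived a unit twist from a bad tower difference found through the generation law E-an-137;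
`…TowerDuality` proved the converse.  Here the generation law is removed from the first direction: the descent runs from ONE bad level-`n`
difference, so the two directions combine into the level-`n` equivalence

* `exists_primitive_even_unit_twist_of_levelDifference` — `f` a rational newform on `Γ₀(N)`, `p` prime, `q ∤ N` an odd prime, `q ≠ p`,
  `p ∤ (q-1)/2`, `n ≥ 2`; a level-`n` difference `{∞,(b+tq^{n-1})/qⁿ}_f − {∞,b/qⁿ}_f` (`q ∤ b`) with plus part `j·Ω⁺_f`, `p ∤ j` ⟹ a PRIMITIVE
  EVEN `χ` mod `qⁿ` with `Σ_a χ(a){∞,a/qⁿ}_f = r·Ω⁺_f`, `s·r/p` never an algebraic integer (`p ∤ s`).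
* `towerLevel_unitTwist_iff_plus_not_dvd` — **THE LEVEL-`n` DUALITY**: (∃ such bad difference) ⟺ (∃ such `χ`, `r`).

Consequence for the cell: the f-specific law E-an-135 `KatoCurve.TowerUnitTwist p` at `(f, q)` is EQUIVALENT to the character-free
statement «for infinitely many `n`, some level-`n` plus coordinate of the `q`-tower of `f` is prime to `p`» — the column the census
(HOME/an/g29/TOWER-an-g29-*.txt, D-an-26) computes.  HONEST FRAMING: bookkeeping; E-an-135 / E-an-137 remain LAWS; nothing about Manin's
conjecture or BSD is asserted.  No definitions.
-/

set_option linter.dupNamespace false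
set_option autoImplicit false

noncomputable section

open scoped Classical MatrixGroups ModularForm ComplexConjugate

open CongruenceSubgroup Complex Literature.NumberTheory.EllipticCurves
  Literature.NumberTheory.EllipticCurves.ModularForms
  Summit.BirchSwinnertonDyer.Rank1Residual.ManinAdditive.Gamma1Lattice
  Summit.BirchSwinnertonDyer.Rank1Residual.ManinAdditive.KatoCurve

namespace Summit.BirchSwinnertonDyer.BirchSwinnertonDyer.Theorems.ManinLocalTwoThree

/-! ### §1 The `ℤ/m` bookkeeping (private copies; cf. `…TowerDescent`, `…TowerDuality`) -/

variable {N : ℕ} [NeZero N] (f : CuspForm (Gamma0 N) 2)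

section Level

variable {m : ℕ} [NeZero m]

omit [NeZero N] [NeZero m] in
/-- `y_0 = 0`. -/
private theorem yL_zero : modularSymbol f (((0 : ZMod m).val : ℚ) / m) - modularSymbol f 0 = 0 := by
  simp [ZMod.val_zero]

omit [NeZero m] in
/-- `y_a ∈ Λ_f` for `m` prime to `N`. -/
private theorem yL_mem_periodLattice (hNm : IsCoprime (N : ℤ) m) (a : ZMod m) :
    modularSymbol f ((a.val : ℚ) / m) - modularSymbol f 0 ∈ periodLattice f := by
  have e : ((a.val : ℤ) : ℚ) / ((m : ℤ) : ℚ) = (a.val : ℚ) / m := by push_cast; rfl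
  rw [← e]
  exact modularSymbol_intCast_div_sub_zero_mem_periodLattice f hNm _ dvd_rfl

/-- `y_{−a} = conj y_a` for real `f`. -/
private theorem yL_neg (hreal : ∀ n, (cuspCoeff f n).im = 0) (a : ZMod m) :
    modularSymbol f (((-a).val : ℚ) / m) - modularSymbol f 0 =
      conj (modularSymbol f ((a.val : ℚ) / m) - modularSymbol f 0) := by
  have h0 : conj (modularSymbol f 0) = modularSymbol f 0 := by
    have := modularSymbol_neg_eq_conj_holds f hreal 0
    rw [neg_zero] at this
    exact this.symm
  by_cases ha : a = 0
  · rw [ha, neg_zero, yL_zero, map_zero]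
  · have hval : (-a).val = m - a.val := by rw [ZMod.neg_val, if_neg ha]
    have hlt : a.val ≤ m := (ZMod.val_lt a).le
    have hmQ : (m : ℚ) ≠ 0 := by exact_mod_cast (NeZero.ne m)
    have e : (((-a).val : ℚ) / m) = -((a.val : ℚ) / m) + ((1 : ℤ) : ℚ) := by
      rw [hval, Nat.cast_sub hlt]
      field_simp
      push_cast
      ring
    rw [e, modularSymbol_add_intCast_holds f, modularSymbol_neg_eq_conj_holds f hreal, map_sub, h0]

/-- `{∞, b/m} = {∞, (b mod m)/m}`. -/
private theorem modularSymbol_intCast_div_eq_valL (b : ℤ) :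
    modularSymbol f ((b : ℚ) / ((m : ℤ) : ℚ)) = modularSymbol f ((((b : ZMod m)).val : ℚ) / m) := by
  have hmQ : (m : ℚ) ≠ 0 := by exact_mod_cast (NeZero.ne m)
  have hv : (((b : ZMod m)).val : ℤ) = b % m := ZMod.val_intCast b
  have hb : (b : ℚ) / ((m : ℤ) : ℚ) = ((((b : ZMod m)).val : ℚ) / m) + ((b / m : ℤ) : ℚ) := by
    have e1 : (b : ℚ) = ((b % m : ℤ) : ℚ) + (m : ℚ) * ((b / m : ℤ) : ℚ) := by
      exact_mod_cast (Int.emod_add_mul_ediv b m).symm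
    have e2 : ((((b : ZMod m)).val : ℚ)) = ((b % m : ℤ) : ℚ) := by exact_mod_cast hv
    rw [e2, e1]
    push_cast
    field_simp
  rw [hb, modularSymbol_add_intCast_holds f]

/-- Half-sum identity: `2 · S_χ = Σ_a χ(a)·(y_a + ȳ_a)` for even `χ ≠ 1` and real `f`. -/
private theorem two_mul_S_eqL (hreal : ∀ n, (cuspCoeff f n).im = 0) {χ : DirichletCharacter ℂ m}
    (hχ : χ ≠ 1) (hev : χ.Even) :
    2 * twistedSymbolSum f χ = ∑ a : ZMod m, χ a * ((modularSymbol f ((a.val : ℚ) / m) - modularSymbol f 0) +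
      conj (modularSymbol f ((a.val : ℚ) / m) - modularSymbol f 0)) := by
  have hS : twistedSymbolSum f χ = ∑ a : ZMod m, χ a * (modularSymbol f ((a.val : ℚ) / m) - modularSymbol f 0) := by
    have : ∑ a : ZMod m, χ a * (modularSymbol f ((a.val : ℚ) / m) - modularSymbol f 0) =
        ∑ a : ZMod m, χ a * modularSymbol f ((a.val : ℚ) / m) - (∑ a : ZMod m, χ a) * modularSymbol f 0 := by
      simp only [mul_sub, Finset.sum_sub_distrib, Finset.sum_mul]
    rw [this, χ.sum_eq_zero_of_ne_one hχ, zero_mul, sub_zero]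
    rfl
  have hS' : twistedSymbolSum f χ =
      ∑ a : ZMod m, χ a * conj (modularSymbol f ((a.val : ℚ) / m) - modularSymbol f 0) := by
    rw [hS]
    refine Fintype.sum_equiv (Equiv.neg (ZMod m)) _ _ fun a ↦ ?_
    rw [Equiv.neg_apply, hev.eval_neg, yL_neg f hreal, Complex.conj_conj]
  rw [two_mul]
  nth_rewrite 1 [hS]
  rw [hS', ← Finset.sum_add_distrib]
  refine Finset.sum_congr rfl fun a _ ↦ ?_
  ring

end Level

/-! ### §2 From ONE bad level-`n` difference to a primitive even unit twist -/

variable {f}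

/-- **Descent at level `n` from one bad difference** (MEMO-an §71.3 «⟸»; the generation-law-free core of
`exists_primitive_even_unit_twist_of_towerGeneration`): a level-`n` tower difference (`n ≥ 2`) with plus part `≢ 0 (mod p)` yields a
PRIMITIVE EVEN `χ` of conductor `qⁿ` with unit normalised twisted value. -/
theorem exists_primitive_even_unit_twist_of_levelDifference (hf : IsNewform0 f) (hQ : coeffField f = ⊥)
    {p : ℕ} (hp : p.Prime) {q : ℕ} [Fact q.Prime] (hq2 : q ≠ 2) (hqp : q ≠ p)
    (hqN : ¬ q ∣ N) (hpq : ¬ p ∣ (q - 1) / 2) {n : ℕ} (hn2 : 2 ≤ n) {b t : ℤ} (hb : ¬ (q : ℤ) ∣ b) {j : ℤ}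
    (hj : (modularSymbol f (((b + t * (q : ℤ) ^ (n - 1) : ℤ) : ℚ) / (q : ℚ) ^ n) - modularSymbol f ((b : ℚ) / (q : ℚ) ^ n)) +
        conj (modularSymbol f (((b + t * (q : ℤ) ^ (n - 1) : ℤ) : ℚ) / (q : ℚ) ^ n) -
          modularSymbol f ((b : ℚ) / (q : ℚ) ^ n)) = (j : ℂ) * (plusPeriod f : ℂ))
    (hjp : ¬ (p : ℤ) ∣ j) :
    ∃ (χ : DirichletCharacter ℂ (q ^ n)) (r : ℂ), χ.IsPrimitive ∧ χ.Even ∧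
      twistedSymbolSum f χ = r * (plusPeriod f : ℂ) ∧ ∀ s : ℕ, ¬ p ∣ s → ¬ IsIntegral ℤ ((s : ℂ) * r / p) := by
  have hq : q.Prime := Fact.out
  have hq3 : 3 ≤ q := by
    rcases hq.eq_two_or_odd' with h | h
    · exact absurd h hq2
    · have := hq.two_le; rcases h with ⟨k, hk⟩; omega
  obtain ⟨hpos, -⟩ := plusPeriod_pos_and_realPeriods_eq isZLattice_periodLattice_holds hf hQ
  have hΩ : (plusPeriod f : ℂ) ≠ 0 := by exact_mod_cast hpos.ne'
  have hreal : ∀ n, (cuspCoeff f n).im = 0 := cuspCoeff_im_eq_zero_of_coeffField_eq_bot hQ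
  haveI : NeZero (q ^ n) := ⟨pow_ne_zero _ hq.ne_zero⟩
  have hqZ : IsCoprime (q : ℤ) b := by
    rw [Int.isCoprime_iff_gcd_eq_one]
    exact (Nat.Prime.coprime_iff_not_dvd hq).mpr fun h ↦ hb (Int.natCast_dvd.mpr h)
  have hNm : IsCoprime (N : ℤ) ((q ^ n : ℕ) : ℤ) := by
    rw [Nat.cast_pow]
    exact IsCoprime.pow_right (Nat.isCoprime_iff_coprime.mpr
      (Nat.coprime_comm.mp ((Nat.Prime.coprime_iff_not_dvd hq).mpr hqN)))
  -- the integer-valued even function `F` on `ℤ/qⁿ`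
  have hF : ∀ a : ZMod (q ^ n), ∃ k : ℤ, (modularSymbol f ((a.val : ℚ) / (q ^ n : ℕ)) - modularSymbol f 0) +
      conj (modularSymbol f ((a.val : ℚ) / (q ^ n : ℕ)) - modularSymbol f 0) = (k : ℂ) * (plusPeriod f : ℂ) :=
    fun a ↦ exists_int_add_conj_eq_mul_plusPeriod hf hQ (yL_mem_periodLattice f hNm a)
  choose F hF using hF
  have hFeven : ∀ a : ZMod (q ^ n), F (-a) = F a := by
    intro a
    have h1 := hF (-a)
    rw [yL_neg f hreal, Complex.conj_conj, add_comm, hF a] at h1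
    exact_mod_cast (mul_right_cancel₀ hΩ h1).symm
  -- `j = F(b') − F(b)` for the residues `b' = b + t q^{n-1}`, `b`
  have hmq : (((q ^ n : ℕ) : ℤ) : ℚ) = (q : ℚ) ^ n := by push_cast; ring
  have hzF : (j : ℂ) * (plusPeriod f : ℂ) =
      ((F ((b + t * (q : ℤ) ^ (n - 1) : ℤ) : ZMod (q ^ n)) - F ((b : ℤ) : ZMod (q ^ n)) : ℤ) : ℂ) *
        (plusPeriod f : ℂ) := by
    rw [← hj, ← hmq, modularSymbol_intCast_div_eq_valL f (b + t * (q : ℤ) ^ (n - 1)),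
      modularSymbol_intCast_div_eq_valL f b]
    have e : modularSymbol f ((((b + t * (q : ℤ) ^ (n - 1) : ℤ) : ZMod (q ^ n)).val : ℚ) / (q ^ n : ℕ)) -
        modularSymbol f ((((b : ℤ) : ZMod (q ^ n)).val : ℚ) / (q ^ n : ℕ)) =
        (modularSymbol f ((((b + t * (q : ℤ) ^ (n - 1) : ℤ) : ZMod (q ^ n)).val : ℚ) / (q ^ n : ℕ)) -
            modularSymbol f 0) -
          (modularSymbol f ((((b : ℤ) : ZMod (q ^ n)).val : ℚ) / (q ^ n : ℕ)) - modularSymbol f 0) := by ring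
    rw [e, map_sub, Int.cast_sub, sub_mul, ← hF, ← hF]
    ring
  have hjF : j = F ((b + t * (q : ℤ) ^ (n - 1) : ℤ) : ZMod (q ^ n)) - F ((b : ℤ) : ZMod (q ^ n)) := by
    have := mul_right_cancel₀ hΩ hzF
    exact_mod_cast this
  -- the residues are units; `u := b' · b⁻¹` lies in the kernel of reduction modulo `q^{n-1}`
  have hbcop : IsCoprime b ((q ^ n : ℕ) : ℤ) := by
    rw [Nat.cast_pow]; exact hqZ.symm.pow_right
  obtain ⟨k, hk⟩ : ∃ k, n - 1 = k + 1 := ⟨n - 2, by omega⟩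
  have hb' : b + t * (q : ℤ) ^ (n - 1) = b + (q : ℤ) * (t * (q : ℤ) ^ k) := by rw [hk, pow_succ]; ring
  have hb'cop : IsCoprime (b + t * (q : ℤ) ^ (n - 1)) ((q ^ n : ℕ) : ℤ) := by
    rw [Nat.cast_pow, hb']
    exact (hqZ.add_mul_left_right (t * (q : ℤ) ^ k)).symm.pow_right
  obtain ⟨ua, hua⟩ : IsUnit ((b : ℤ) : ZMod (q ^ n)) := (ZMod.coe_int_isUnit_iff_isCoprime b (q ^ n)).mpr hbcop.symm
  obtain ⟨ua', hua'⟩ : IsUnit (((b + t * (q : ℤ) ^ (n - 1) : ℤ)) : ZMod (q ^ n)) :=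
    (ZMod.coe_int_isUnit_iff_isCoprime _ (q ^ n)).mpr hb'cop.symm
  have hu_mul : ((ua' * ua⁻¹ : (ZMod (q ^ n))ˣ) : ZMod (q ^ n)) * (ua : ZMod (q ^ n)) =
      ((b + t * (q : ℤ) ^ (n - 1) : ℤ) : ZMod (q ^ n)) := by
    rw [← Units.val_mul, inv_mul_cancel_right, hua']
  have hu_ker : (ua' * ua⁻¹ : (ZMod (q ^ n))ˣ) ∈ (ZMod.unitsMap (pow_dvd_pow q (Nat.sub_le n 1))).ker := by
    rw [MonoidHom.mem_ker, map_mul, map_inv, mul_inv_eq_one]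
    apply Units.ext
    rw [ZMod.unitsMap_val, ZMod.unitsMap_val, hua, hua', ZMod.cast_intCast (pow_dvd_pow q (Nat.sub_le n 1)),
      ZMod.cast_intCast (pow_dvd_pow q (Nat.sub_le n 1)), hk]
    push_cast
    rw [← Nat.cast_pow, ZMod.natCast_self]
    ring
  -- `p ∤ φ(qⁿ)/2 = q^{n-1} (q-1)/2`, `qⁿ > 2`
  have hqodd : q % 2 = 1 := hq.eq_two_or_odd.resolve_left hq2
  have hφ : ¬ p ∣ (q ^ n).totient / 2 := by
    rw [Nat.totient_prime_pow hq (by omega), Nat.mul_div_assoc _ (show 2 ∣ q - 1 by omega)]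
    intro h
    rcases (Nat.Prime.dvd_mul hp).mp h with h1 | h1
    · exact hqp ((Nat.prime_dvd_prime_iff_eq hp hq).mp (hp.dvd_of_dvd_pow h1)).symm
    · exact hpq h1
  have h2m : 2 < q ^ n := lt_of_lt_of_le (by omega) (Nat.le_self_pow (by omega) q)
  -- §4: the even span lemma, contrapositively
  have hex : ∃ χ : DirichletCharacter ℂ (q ^ n), χ.Even ∧ χ ((ua' * ua⁻¹ : (ZMod (q ^ n))ˣ) : ZMod (q ^ n)) ≠ 1 ∧
      ∀ s : ℕ, ¬ p ∣ s → ¬ IsIntegral ℤ ((s : ℂ) * (∑ a : ZMod (q ^ n), χ a * (F a : ℂ)) / (2 * p)) := by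
    by_contra hcon
    push Not at hcon
    have h := Int.dvd_sub_of_forall_even_isIntegral_charSum_div_of_apply_ne_one h2m hp hφ F hFeven
      (Units.isUnit (ua' * ua⁻¹)) (fun χ he hne ↦ hcon χ he hne) (Units.isUnit ua)
    rw [hu_mul, hua, ← hjF] at h
    exact hjp h
  obtain ⟨χ, hev, hχu, hχ⟩ := hex
  have hprim : χ.IsPrimitive := DirichletCharacter.isPrimitive_of_apply_ne_one_of_mem_ker hq hu_ker hχu
  have hχ1 : χ ≠ 1 := fun h ↦ hχu (by rw [h, MulChar.one_apply_coe])
  -- §5: half-sum identity, `r = F̂(χ)/2`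
  refine ⟨χ, (∑ a : ZMod (q ^ n), χ a * (F a : ℂ)) / 2, hprim, hev, ?_, ?_⟩
  · have h2 := two_mul_S_eqL f hreal hχ1 hev
    simp_rw [hF, ← mul_assoc, ← Finset.sum_mul] at h2
    have : twistedSymbolSum f χ = (∑ a : ZMod (q ^ n), χ a * (F a : ℂ)) * (plusPeriod f : ℂ) / 2 := by
      rw [← h2]; ring
    rw [this]; ring
  · intro s hs hI
    refine hχ s hs ?_
    have e : ((s : ℂ) * (∑ a : ZMod (q ^ n), χ a * (F a : ℂ)) / (2 * p)) =
        (s : ℂ) * ((∑ a : ZMod (q ^ n), χ a * (F a : ℂ)) / 2) / p := by ring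
    rwa [e]

/-! ### §3 The level-`n` duality -/

/-- **LEVEL-`n` FOURIER DUALITY (MEMO-an §71.3)**: for a rational newform `f` on `Γ₀(N)`, a prime `p`, an odd prime `q ∤ N` with `q ≠ p`,
`p ∤ (q-1)/2`, and `n ≥ 2`: some level-`n` `q`-tower difference has plus part `≢ 0 (mod p)` IFF some primitive even Dirichlet character
of conductor `qⁿ` has `Σ_a χ(a){∞, a/qⁿ}_f = r·Ω⁺_f` with `s·r/p` never an algebraic integer (`p ∤ s`). -/
theorem towerLevel_unitTwist_iff_plus_not_dvd (hf : IsNewform0 f) (hQ : coeffField f = ⊥)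
    {p : ℕ} (hp : p.Prime) {q : ℕ} [Fact q.Prime] (hq2 : q ≠ 2) (hqp : q ≠ p)
    (hqN : ¬ q ∣ N) (hpq : ¬ p ∣ (q - 1) / 2) {n : ℕ} (hn2 : 2 ≤ n) :
    (∃ b t : ℤ, ¬ (q : ℤ) ∣ b ∧ ∃ j : ℤ,
      (modularSymbol f (((b + t * (q : ℤ) ^ (n - 1) : ℤ) : ℚ) / (q : ℚ) ^ n) - modularSymbol f ((b : ℚ) / (q : ℚ) ^ n)) +
        conj (modularSymbol f (((b + t * (q : ℤ) ^ (n - 1) : ℤ) : ℚ) / (q : ℚ) ^ n) -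
          modularSymbol f ((b : ℚ) / (q : ℚ) ^ n)) = (j : ℂ) * (plusPeriod f : ℂ) ∧ ¬ (p : ℤ) ∣ j) ↔
    (∃ (χ : DirichletCharacter ℂ (q ^ n)) (r : ℂ), χ.IsPrimitive ∧ χ.Even ∧
      twistedSymbolSum f χ = r * (plusPeriod f : ℂ) ∧ ∀ s : ℕ, ¬ p ∣ s → ¬ IsIntegral ℤ ((s : ℂ) * r / p)) := by
  constructor
  · rintro ⟨b, t, hb, j, hj, hjp⟩
    exact exists_primitive_even_unit_twist_of_levelDifference hf hQ hp hq2 hqp hqN hpq hn2 hb hj hjp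
  · rintro ⟨χ, r, hprim, hev, hr, hunit⟩
    exact exists_levelDifference_plus_not_dvd_of_unitTwist hf hQ hp hq2 hqp hqN hn2 hprim hev hr hunit

end Summit.BirchSwinnertonDyer.BirchSwinnertonDyer.Theorems.ManinLocalTwoThree

end
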